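import Literature.Probability.LatticeModels.CriticalEtaUpperDCPProofs
import Literature.Probability.LatticeModels.IsingExponents
import HarnessLib

/-!
# Split glue for crux `EtaPositive` (item stmt-CriticalPhenomena-2600) ⟸ `EtaExists` (item 0635) ∧ `EtaGainIO`

THEOREM-ONLY helper file (`--supports stmt-CriticalPhenomena-2600`; no definition, no named fact, no `sorry`), prepared by the
crux-strategist seat `cstrat-stmt-CriticalPhenomena-2600-s1` for the route split
`EtaPositive ⟶ EtaExists ∧ EtaGainIO` on `route-CriticalPhenomena-AnomalousForcesInteraction` (D-0019 glued split, `--glue-by`).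
The module imports NO route (`Theses`) file, so the route file can import it without a cycle; every statement is written as the
RAW proposition (the bodies of the route decls), accepted at the route copies by `δ`-unfolding.

The decomposition is **regularity × sign**:

* `EtaExists` (item stmt-CriticalPhenomena-0635, shared with `IsingEuclidUpgrade` r3 / `FilmLadder` target):
  `∃ η, HasIsingExponentEta 3 η` — the logarithmic exponent `log⟨σ₀σ_x⟩/log‖x‖ → −(1+η)` EXISTS (no sign information);
* `EtaGainIO` (new child): `∃ κ > 0, C, ∀ N, ∃ x, N < ‖x‖ ∧ ⟨σ₀σ_x⟩ ≤ C‖x‖^{-(1+κ)}` — a power GAIN over the infrared bound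
  at infinitely many (arbitrarily far) sites (no regularity information; strictly weaker than the crux, `etaGainIO_of_etaPositive`).

Kernel-checked here:

* `kappa_le_eta_of_gainIO` — if the logarithmic exponent is `η` and the gain `κ` occurs at arbitrarily far sites, then `κ ≤ η`;
* `etaPositive_of_etaExists_of_etaGainIO` — **the glue** `EtaExists → EtaGainIO → EtaPositive` (so `η ≥ κ > 0`, then
  `⟨σ₀σ_x⟩ ≤ K‖x‖^{-(1+η/2)}` for all `x ≠ 0` by `HasSpatialDecayExponent.exists_le_mul_rpow`);
* `etaGainIO_of_etaPositive` — the child is implied by the parent (axis points `(N+1)e₁`);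
* `etaGainIO_iff_not_hasIsingExponentEta_zero` — given the infrared bound `⟨σ₀σ_x⟩ ≤ C‖x‖^{-1}`
  (`criticalTwoPoint_bounds_holds`), `EtaGainIO` is EXACTLY the negation of the canonical-branch hypothesis
  `HasIsingExponentEta 3 0` (`η_log = 0`, the statement of the closed item stmt-CriticalPhenomena-15521): the only way the gain
  can fail at all far sites for every `κ > 0` is two-sided logarithmic saturation of the infrared bound.

References: H. Duminil-Copin, R. Panis, CMP 406 (2025), arXiv:2404.05700, eq. (1.3) and Theorem 1.5
[DuminilCopinPanis2025LowerBounds]; M. E. Fisher, Phys. Rev. 180 (1969) 594 (`η ≥ 0`); H. Duminil-Copin, ICM 2022 §4.1, §9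
[DuminilCopinICM2022] (existence of `η(3)` open).
-/

noncomputable section

namespace Summit.CriticalPhenomena.Ising3DConformalLimit.Cruxes.EtaPositive.SplitGlue

open Literature.Probability.LatticeModels Filter
open _root_.Topology

/-- The logarithmic ratio `log⟨σ₀σ_x⟩ / log‖x‖` of `HasIsingExponentEta 3 η`, with the cast `(3:ℕ) - 2 + η = 1 + η`
normalised. [folklore] -/
theorem tendsto_ratio_of_hasIsingExponentEta {η : ℝ} (hη : HasIsingExponentEta 3 η) :
    Tendsto (fun x : Site 3 => Real.log (criticalTwoPoint 3 x) / Real.log ‖x‖) cofinite (𝓝 (-(1 + η))) := by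
  have h' : HasSpatialDecayExponent (criticalTwoPoint 3) (((3 : ℕ) : ℝ) - 2 + η) := hη
  have he : (-(((3 : ℕ) : ℝ) - 2 + η)) = -(1 + η) := by push_cast; ring
  simpa only [HasSpatialDecayExponent, he] using h'

/-- **Gain at arbitrarily far sites caps below the logarithmic exponent.** If `log⟨σ₀σ_x⟩/log‖x‖ → −(1+η)` cofinitely and
for every `N` some site `x` with `‖x‖ > N` has `⟨σ₀σ_x⟩ ≤ C‖x‖^{-(1+κ)}`, then `κ ≤ η`. (Otherwise, with `ε = (κ−η)/2`,
cofinitely the ratio exceeds `−(1+η)−ε` while at the far gain sites it is below `log C/log‖x‖ − (1+κ) < ε − (1+κ)`.)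
[folklore] -/
theorem kappa_le_eta_of_gainIO {η κ C : ℝ} (hη : HasIsingExponentEta 3 η)
    (hio : ∀ N : ℕ, ∃ x : Site 3, (N : ℝ) < ‖x‖ ∧ criticalTwoPoint 3 x ≤ C * (‖x‖ : ℝ) ^ (-(1 + κ))) :
    κ ≤ η := by
  by_contra hlt
  push Not at hlt
  set ε : ℝ := (κ - η) / 2 with hε_def
  have hε : 0 < ε := by rw [hε_def]; linarith
  -- a positive constant dominating `C`
  set C' : ℝ := max C 1 with hC'_def
  have hC'pos : 0 < C' := lt_of_lt_of_le one_pos (le_max_right _ _)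
  have hlim := tendsto_ratio_of_hasIsingExponentEta hη
  have hlog : Tendsto (fun x : Site 3 => Real.log ‖x‖) cofinite atTop :=
    Real.tendsto_log_atTop.comp Site.tendsto_norm_cofinite_atTop
  have h1 : ∀ᶠ x : Site 3 in cofinite, -(1 + η) - ε < Real.log (criticalTwoPoint 3 x) / Real.log ‖x‖ :=
    hlim.eventually (Ioi_mem_nhds (by linarith))
  have h2 : ∀ᶠ x : Site 3 in cofinite, Real.log C' / Real.log ‖x‖ < ε :=
    (Tendsto.div_atTop tendsto_const_nhds hlog).eventually (Iio_mem_nhds hε)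
  have h3 : ∀ᶠ x : Site 3 in cofinite, (1 : ℝ) < ‖x‖ :=
    Site.tendsto_norm_cofinite_atTop.eventually_gt_atTop 1
  have hall := h1.and (h2.and h3)
  -- the finite exceptional set is norm-bounded
  have hfin := Filter.eventually_cofinite.1 hall
  obtain ⟨M, hM⟩ := (hfin.image fun x : Site 3 => ‖x‖).bddAbove
  obtain ⟨x, hxN, hxG⟩ := hio ⌈M⌉₊
  have hxM : M < ‖x‖ := lt_of_le_of_lt (Nat.le_ceil M) hxN
  have hx : -(1 + η) - ε < Real.log (criticalTwoPoint 3 x) / Real.log ‖x‖ ∧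
      Real.log C' / Real.log ‖x‖ < ε ∧ (1 : ℝ) < ‖x‖ := by
    by_contra hcon
    have hmem : ‖x‖ ∈ (fun y : Site 3 => ‖y‖) '' {y : Site 3 | ¬(-(1 + η) - ε <
        Real.log (criticalTwoPoint 3 y) / Real.log ‖y‖ ∧ Real.log C' / Real.log ‖y‖ < ε ∧ (1 : ℝ) < ‖y‖)} :=
      ⟨x, hcon, rfl⟩
    exact absurd (hM hmem) (not_le.2 hxM)
  obtain ⟨hx1, hx2, hx3⟩ := hx
  have hxpos : 0 < ‖x‖ := by linarith
  have hxne : x ≠ 0 := norm_pos_iff.1 hxpos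
  have hlogx : 0 < Real.log ‖x‖ := Real.log_pos hx3
  have hGpos : 0 < criticalTwoPoint 3 x := by
    -- Simon–Lieb lower bound `0 < c‖x‖⁻² ≤ ⟨σ₀σ_x⟩` (`criticalTwoPoint_bounds_holds`; landed as
    -- `Theorems.criticalTwoPoint_three_pos_of_ne_zero` in a route-importing module, not imported here on purpose)
    obtain ⟨c, _C, hc, hbd⟩ := criticalTwoPoint_bounds_holds (d := 3) le_rfl
    exact lt_of_lt_of_le (mul_pos hc (Real.rpow_pos_of_pos hxpos _)) (hbd x hxne).1
  -- at `x`: `log G ≤ log C' - (1+κ) log ‖x‖`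
  have hGle : criticalTwoPoint 3 x ≤ C' * ‖x‖ ^ (-(1 + κ)) :=
    hxG.trans (mul_le_mul_of_nonneg_right (le_max_left _ _) (Real.rpow_nonneg hxpos.le _))
  have hlogG : Real.log (criticalTwoPoint 3 x) ≤ Real.log C' + (-(1 + κ)) * Real.log ‖x‖ := by
    have := Real.log_le_log hGpos hGle
    rwa [Real.log_mul hC'pos.ne' (Real.rpow_pos_of_pos hxpos _).ne', Real.log_rpow hxpos] at this
  have hratio : Real.log (criticalTwoPoint 3 x) / Real.log ‖x‖ ≤ Real.log C' / Real.log ‖x‖ - (1 + κ) := by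
    rw [div_le_iff₀ hlogx, sub_mul, div_mul_cancel₀ _ hlogx.ne']
    linarith
  -- combine: `-(1+η) - ε < ε - (1+κ)`, i.e. `κ - η < 2ε = κ - η`
  have : -(1 + η) - ε < ε - (1 + κ) := by linarith
  rw [hε_def] at this
  linarith

/-- **The glue `EtaExists → EtaGainIO → EtaPositive`** (regularity × sign): if the logarithmic exponent `η(3)` exists
(item stmt-CriticalPhenomena-0635) and a power gain `κ > 0` over the infrared bound occurs at arbitrarily far sites, then
`η ≥ κ > 0` (`kappa_le_eta_of_gainIO`) and hence `⟨σ₀σ_x⟩ ≤ K‖x‖^{-(1+η/2)}` for all `x ≠ 0`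
(`HasSpatialDecayExponent.exists_le_mul_rpow`), which is item stmt-CriticalPhenomena-2600 `EtaPositive` with `κ = η/2`.
Stated over the raw bodies of the route decls (no route import). [folklore] -/
theorem etaPositive_of_etaExists_of_etaGainIO : (∃ η : ℝ, Literature.Probability.LatticeModels.HasIsingExponentEta 3 η) → (∃ κ C : ℝ, 0 < κ ∧ ∀ N : ℕ, ∃ x : Literature.Probability.LatticeModels.Site 3, (N : ℝ) < ‖x‖ ∧ Literature.Probability.LatticeModels.criticalTwoPoint 3 x ≤ C * (‖x‖ : ℝ) ^ (-(1 + κ))) → (∃ κ C : ℝ, 0 < κ ∧ ∀ x : Literature.Probability.LatticeModels.Site 3, x ≠ 0 → Literature.Probability.LatticeModels.criticalTwoPoint 3 x ≤ C * (‖x‖ : ℝ) ^ (-(1 + κ))) := by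
  rintro ⟨η, hη⟩ ⟨κ, C, hκ, hio⟩
  have hηpos : 0 < η := lt_of_lt_of_le hκ (kappa_le_eta_of_gainIO hη hio)
  have h' : HasSpatialDecayExponent (criticalTwoPoint 3) (((3 : ℕ) : ℝ) - 2 + η) := hη
  obtain ⟨K, -, hK⟩ := h'.exists_le_mul_rpow (half_pos hηpos)
  refine ⟨η / 2, K, half_pos hηpos, fun x hx => ?_⟩
  have he : (-(((3 : ℕ) : ℝ) - 2 + η) + η / 2) = -(1 + η / 2) := by push_cast; ring
  simpa only [he] using hK x hx

/-- The child `EtaGainIO` is implied by the parent `EtaPositive` (take the axis sites `(N+1)e₁`). [folklore] -/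
theorem etaGainIO_of_etaPositive : (∃ κ C : ℝ, 0 < κ ∧ ∀ x : Literature.Probability.LatticeModels.Site 3, x ≠ 0 → Literature.Probability.LatticeModels.criticalTwoPoint 3 x ≤ C * (‖x‖ : ℝ) ^ (-(1 + κ))) → (∃ κ C : ℝ, 0 < κ ∧ ∀ N : ℕ, ∃ x : Literature.Probability.LatticeModels.Site 3, (N : ℝ) < ‖x‖ ∧ Literature.Probability.LatticeModels.criticalTwoPoint 3 x ≤ C * (‖x‖ : ℝ) ^ (-(1 + κ))) := by
  rintro ⟨κ, C, hκ, h⟩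
  refine ⟨κ, C, hκ, fun N => ⟨Pi.single 0 ((N + 1 : ℕ) : ℤ), ?_, h _ ?_⟩⟩
  · rw [Pi.norm_single, Int.norm_natCast]
    push_cast
    linarith
  · intro h0
    have := congr_fun h0 0
    simp at this
    omega

/-- **`EtaGainIO` refutes the canonical branch**: a gain at arbitrarily far sites is incompatible with `η_log = 0`
(`HasIsingExponentEta 3 0`, the statement of item stmt-CriticalPhenomena-15521). [folklore] -/
theorem not_hasIsingExponentEta_zero_of_etaGainIO (h : ∃ κ C : ℝ, 0 < κ ∧ ∀ N : ℕ, ∃ x : Literature.Probability.LatticeModels.Site 3, (N : ℝ) < ‖x‖ ∧ Literature.Probability.LatticeModels.criticalTwoPoint 3 x ≤ C * (‖x‖ : ℝ) ^ (-(1 + κ))) :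
    ¬ HasIsingExponentEta 3 0 := by
  rintro h0
  obtain ⟨κ, C, hκ, hio⟩ := h
  exact absurd (kappa_le_eta_of_gainIO h0 hio) (not_le.2 hκ)

/-- **Conversely, off the canonical branch the gain occurs**: by the infrared bound `⟨σ₀σ_x⟩ ≤ C‖x‖^{-1}`
(`criticalTwoPoint_bounds_holds`) the logarithmic ratio is cofinitely `< −1 + ε`; if moreover NO gain `κ = ε` occurred beyond
some radius, the ratio would cofinitely be `> −1 − ε`, for every `ε > 0` — i.e. `η_log = 0`. [folklore] -/
theorem etaGainIO_of_not_hasIsingExponentEta_zero (h0 : ¬ HasIsingExponentEta 3 0) : ∃ κ C : ℝ, 0 < κ ∧ ∀ N : ℕ, ∃ x : Literature.Probability.LatticeModels.Site 3, (N : ℝ) < ‖x‖ ∧ Literature.Probability.LatticeModels.criticalTwoPoint 3 x ≤ C * (‖x‖ : ℝ) ^ (-(1 + κ)) := by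
  by_contra hno
  push Not at hno
  apply h0
  -- goal: the ratio tends to `-((3:ℕ) - 2 + 0) = -1`
  have he : (-(((3 : ℕ) : ℝ) - 2 + 0)) = -1 := by push_cast; ring
  show Tendsto (fun x : Site 3 => Real.log (criticalTwoPoint 3 x) / Real.log ‖x‖) cofinite (𝓝 (-(((3 : ℕ) : ℝ) - 2 + 0)))
  rw [he]
  have hlog : Tendsto (fun x : Site 3 => Real.log ‖x‖) cofinite atTop :=
    Real.tendsto_log_atTop.comp Site.tendsto_norm_cofinite_atTop
  obtain ⟨c, C, hc, hbd⟩ := criticalTwoPoint_bounds_holds (d := 3) le_rfl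
  set C' : ℝ := max C 1 with hC'_def
  have hC'pos : 0 < C' := lt_of_lt_of_le one_pos (le_max_right _ _)
  rw [tendsto_order]
  refine ⟨fun a ha => ?_, fun b hb => ?_⟩
  · -- lower side: no gain `κ = (-1 - a)/2 > 0` with constant `1` beyond radius `N`
    set κ : ℝ := (-1 - a) / 2 with hκ_def
    have hκ : 0 < κ := by rw [hκ_def]; linarith
    obtain ⟨N, hN⟩ := hno κ 1 hκ
    have h3 : ∀ᶠ x : Site 3 in cofinite, (1 : ℝ) < ‖x‖ :=
      Site.tendsto_norm_cofinite_atTop.eventually_gt_atTop 1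
    have h4 : ∀ᶠ x : Site 3 in cofinite, (N : ℝ) < ‖x‖ :=
      Site.tendsto_norm_cofinite_atTop.eventually_gt_atTop (N : ℝ)
    filter_upwards [h3, h4] with x hx1 hxN
    have hxpos : 0 < ‖x‖ := by linarith
    have hlogx : 0 < Real.log ‖x‖ := Real.log_pos hx1
    have hG : 1 * ‖x‖ ^ (-(1 + κ)) < criticalTwoPoint 3 x := hN x hxN
    rw [one_mul] at hG
    have hlogG : (-(1 + κ)) * Real.log ‖x‖ < Real.log (criticalTwoPoint 3 x) := by
      have := Real.log_lt_log (Real.rpow_pos_of_pos hxpos _) hG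
      rwa [Real.log_rpow hxpos] at this
    have : -(1 + κ) < Real.log (criticalTwoPoint 3 x) / Real.log ‖x‖ := by
      rwa [lt_div_iff₀ hlogx]
    have hak : a < -(1 + κ) := by rw [hκ_def]; linarith
    exact hak.trans this
  · -- upper side: the infrared bound
    have h2 : ∀ᶠ x : Site 3 in cofinite, Real.log C' / Real.log ‖x‖ < b - (-1) :=
      (Tendsto.div_atTop tendsto_const_nhds hlog).eventually (Iio_mem_nhds (by linarith))
    have h3 : ∀ᶠ x : Site 3 in cofinite, (1 : ℝ) < ‖x‖ :=
      Site.tendsto_norm_cofinite_atTop.eventually_gt_atTop 1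
    filter_upwards [h2, h3] with x hx2 hx1
    have hxpos : 0 < ‖x‖ := by linarith
    have hxne : x ≠ 0 := norm_pos_iff.1 hxpos
    have hlogx : 0 < Real.log ‖x‖ := Real.log_pos hx1
    have hGpos : 0 < criticalTwoPoint 3 x :=
      lt_of_lt_of_le (mul_pos hc (Real.rpow_pos_of_pos hxpos _)) (hbd x hxne).1
    have hGle : criticalTwoPoint 3 x ≤ C' * ‖x‖ ^ (-(((3 : ℕ) : ℝ) - 2)) :=
      (hbd x hxne).2.trans (mul_le_mul_of_nonneg_right (le_max_left _ _) (Real.rpow_nonneg hxpos.le _))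
    have he' : (-(((3 : ℕ) : ℝ) - 2)) = -1 := by push_cast; ring
    rw [he'] at hGle
    have hlogG : Real.log (criticalTwoPoint 3 x) ≤ Real.log C' + (-1) * Real.log ‖x‖ := by
      have := Real.log_le_log hGpos hGle
      rwa [Real.log_mul hC'pos.ne' (Real.rpow_pos_of_pos hxpos _).ne', Real.log_rpow hxpos] at this
    have hratio : Real.log (criticalTwoPoint 3 x) / Real.log ‖x‖ ≤ Real.log C' / Real.log ‖x‖ - 1 := by
      rw [div_le_iff₀ hlogx, sub_mul, div_mul_cancel₀ _ hlogx.ne']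
      linarith
    linarith

/-- `EtaGainIO ⟺ ¬(η_log = 0)`: the new child of the split is exactly the negation of the canonical-branch hypothesis
`HasIsingExponentEta 3 0` (item stmt-CriticalPhenomena-15521), unconditionally (the infrared bound is a theorem). [folklore] -/
theorem etaGainIO_iff_not_hasIsingExponentEta_zero : (∃ κ C : ℝ, 0 < κ ∧ ∀ N : ℕ, ∃ x : Literature.Probability.LatticeModels.Site 3, (N : ℝ) < ‖x‖ ∧ Literature.Probability.LatticeModels.criticalTwoPoint 3 x ≤ C * (‖x‖ : ℝ) ^ (-(1 + κ))) ↔ ¬ HasIsingExponentEta 3 0 :=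
  ⟨not_hasIsingExponentEta_zero_of_etaGainIO, etaGainIO_of_not_hasIsingExponentEta_zero⟩

end Summit.CriticalPhenomena.Ising3DConformalLimit.Cruxes.EtaPositive.SplitGlue

end
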